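import Mathlib.LinearAlgebra.Matrix.BilinearForm
import Literature.Topology.FourManifolds.HCobordismDonaldson
import Literature.Topology.FourManifolds.LatticeForms
import Literature.Topology.FourManifolds.LatticeFormsParity
import Literature.Topology.FourManifolds.LatticeFormsUnitBasis
import HarnessLib

/-!
# Towards `akhmedovPark2010_exotic_bTwo_three_holds`: Akhmedov–Park's exotic `ℂℙ² # 2ℂℙ²bar`
# family, decomposed along the printed proof

Sibling proof file of `SmallExoticaFrontier.lean` for the named fact
`Literature.Barriers.SmoothPoincare4.akhmedovPark2010_exotic_bTwo_three` (A. Akhmedov, B. D. Park,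
*Exotic smooth structures on small 4-manifolds with odd signatures*, Invent. Math. 181 (2010)
577–603, arXiv:math/0701829, Thm. 1 (i) with `m = 2`: a simply connected closed smooth 4-manifold
`M` with `H₂(M; ℤ) ≅ ℤ³` and pairwise non-diffeomorphic closed smooth `N₀, N₁, …` homeomorphic to
`M`). Provefact triage **XL**: an unconditional proof packages Seiberg–Witten theory, Wall's
h-cobordism theorem and Freedman's topological h-cobordism theorem, none of which is a theorem of
Mathlib or of the tree. This file decomposes the fact ALONG THE PRINTED PROOF into one new named
fact (the smooth content of the paper's Lemma 8) and two named facts already in the tree, and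
proves the **assembly step** sorry-free.

## The printed proof (§9 "Construction of exotic `ℂℙ² # 2ℂℙ²bar`", Lemma 8 and its proof)

`X₁(m) = Y₁(1,1) #_ψ Z''(1,m)` (`m ≥ 1`), a normal connected sum along genus-2 surfaces of
Luttinger-surgered `Σ₂ × T²` and `T⁴ # ℂℙ²bar`. Lemma 8: "The set `S_{1,2} = {X₁(m) | m ≥ 1}`
consists of irreducible 4-manifolds that are homeomorphic to `ℂℙ² # 2ℂℙ²bar`. Moreover, `S_{1,2}`
contains an infinite subset consisting of pairwise non-diffeomorphic non-symplectic 4-manifolds."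
Proof, as printed: (a) `e(X₁(m)) = 0 + 1 + 4 = 5`, `σ(X₁(m)) = 0 + (−1) = −1`; (b) `π₁(X₁(m)) = 1`
(Seifert–van Kampen and the Luttinger-surgery relations, §§5–9); (c) "From Freedman's theorem
(cf. [freedman]), we conclude that `X₁(m)` is homeomorphic to `ℂℙ² # 2ℂℙ²bar`"; (d) "view `X₁(m)`
as the result of 5 Luttinger surgeries and a single `m` torus surgery on the symplectic normal
connected sum `(Σ₂ × T²) #_ψ (T⁴ # ℂℙ²bar)`, which is a minimal symplectic 4-manifold with
`b₂⁺ > 1` … compute the Seiberg–Witten invariants of `X₁(m)` and check that infinitely many of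
them are distinct by applying exactly the same argument as in [ABP, FPS] using the product
formulas in [MMS]". (Irreducibility — Usher, Hamilton–Kotschick, Li — and non-symplecticity —
Taubes — are not rendered by the tree's fact.)

For SMOOTH simply connected closed 4-manifolds, step (c) "Freedman's theorem" (uniqueness half of
Freedman 1982, Thm. 1.5) is the composite of Wall's theorem (isometric intersection forms ⇒
smoothly h-cobordant; Wall 1964, Thm. 2) and Freedman's 5-dimensional topological h-cobordism
theorem (Freedman 1982, Thm. 1.3; Freedman–Quinn Thm. 7.1A), exactly as in the tree's rendering of
Donaldson's counterexample (`Literature/Topology/FourManifolds/HCobordismDonaldson.lean`).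

## What is here

* `stdOddFormOneTwo` — the lattice `I₊ ⊕ 2I₋ = ⟨1⟩ ⊕ ⟨−1⟩ ⊕ ⟨−1⟩` on `ℤ³`
  (`Matrix.toBilin' (Matrix.diagonal ![1, -1, -1])`), the intersection form of `ℂℙ² # 2ℂℙ²bar`
  (Gompf–Stipsicz 1999, §1.2: `Q_{ℂℙ²} = ⟨1⟩`, `Q_{ℂℙ²bar} = ⟨−1⟩`, `Q_{X # Y} = Q_X ⊕ Q_Y`), with
  PROVED API: symmetric, odd, diagonalisable, rank `3`, signature `−1` (Serre, Ch. V §1.4.1);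
  hence an oriented closed 4-manifold with this form has `σ = −1`, odd type and `b₂ = 3`
  (`signature_eq_neg_one_of_equivalent_stdOddFormOneTwo`, `isOdd_intersectionForm_…`,
  `finrank_freeCohomology_eq_three_…`) — the printed data `(e, σ) = (5, −1)` of `X₁(m)`.
* NAMED FACT `akhmedovPark2010_lemma8_family` — the smooth content of Lemma 8 and its proof,
  steps (a), (b), (d): a sequence `X₀, X₁, …` of simply connected closed smooth 4-manifolds,
  pairwise non-diffeomorphic, each carrying a `ℤ`-orientation whose intersection form is
  isometric to `I₊ ⊕ 2I₋` and with `H₂(X m; ℤ) ≅ ℤ³` (both consequences of the printed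
  `e = 5, σ = −1, π₁ = 1`, equivalently of "homeomorphic to `ℂℙ² # 2ℂℙ²bar`"). Weaker than the
  printed lemma (no irreducibility, no symplectic member, the family re-indexed by `ℕ`), never
  stronger. NOT dischargeable here (Seiberg–Witten theory); users take
  `(h : akhmedovPark2010_lemma8_family)`.
* PROVED assembly `akhmedovPark2010_exotic_bTwo_three_of_wallThmTwo_of_freedman`:
  Wall's Thm. 2 (`Literature.Topology.FourManifolds.isHCobordant_of_equivalent_intersectionForm`)
  → Freedman's h-cobordism theorem
  (`Literature.Topology.FourManifolds.nonempty_homeomorph_of_isHCobordant_four`) → the leaf → the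
  target: `M := X 0`, `N := X`; `Q_{X i} ≅ I₊ ⊕ 2I₋ ≅ Q_{X 0}`, so `X i`, `X 0` are h-cobordant
  (Wall) and homeomorphic (Freedman) — step (c) as printed. Variant `…_of_wall_of_freedman` from
  the tree's combined Wall fact `Literature.Topology.FourManifolds.isHCobordant_and_exists_isStabilization`
  (Thms. 2 ∧ 3), and the barrier corollary `smallExoticaBarrier_of_wall_of_freedman_of_lemma8`.

So `akhmedovPark2010_exotic_bTwo_three` rests on three named facts — Wall 1964 Thm. 2, Freedman
1982 Thm. 1.3, and the Seiberg–Witten leaf `akhmedovPark2010_lemma8_family` — and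
`akhmedovPark2010_exotic_bTwo_three_holds` needs all three discharged: 5-dimensional surgery and
`Ω₄^{SO} ≅ ℤ` (Wall), Casson handles / Bing topology (Freedman), and the construction of `X₁(m)`
with Seiberg–Witten product formulas (Akhmedov–Park). None is in Mathlib or the tree.

## References

[AkhmedovPark2010] [WallJLMS1964] [FreedmanJDG1982] [FreedmanQuinnPMS1990] [Serre1973]
[GompfStipsicz1999] [MilnorHusemoller1973]
-/

noncomputable section

open scoped Manifold ContDiff
open CategoryTheory LinearMap.BilinForm

namespace Literature.Barriers.SmoothPoincare4

/-- Local notation: `𝔼 n` is the model Euclidean space `EuclideanSpace ℝ (Fin n)`. -/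
local notation "𝔼 " n:arg => EuclideanSpace ℝ (Fin n)

/-- Local notation: `Q⟦μ⟧` is the intersection form
`Literature.AlgebraicTopology.SingularHomology.intersectionForm two_add_two_eq_four μ` on `H²(M; ℤ)/T`
of the closed `ℤ`-oriented topological 4-manifold `(M, μ)` (as in `SmoothIntersectionForms.lean`,
`HCobordismDonaldson.lean`). -/
local notation "Q⟦" μ "⟧" =>
  Literature.AlgebraicTopology.SingularHomology.intersectionForm two_add_two_eq_four μ

/-! ### The lattice `I₊ ⊕ 2I₋`, intersection form of `ℂℙ² # 2ℂℙ²bar` -/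

/-- The signs `(1, −1, −1)` of the diagonal lattice `I₊ ⊕ 2I₋`. [folklore] -/
def stdOddSignsOneTwo : Fin 3 → ℤ := ![1, -1, -1]

/-- **The lattice `I₊ ⊕ 2I₋ = ⟨1⟩ ⊕ ⟨−1⟩ ⊕ ⟨−1⟩`** on `ℤ³`: the symmetric bilinear form with Gram
matrix `diag(1, −1, −1)` in the standard basis (Serre, *A Course in Arithmetic*, Ch. V §1.4.1,
`s I₊ ⊕ t I₋` with `(s, t) = (1, 2)`). It is the intersection form of `ℂℙ² # 2ℂℙ²bar` for the
orientation inducing the complex orientation on the `ℂℙ²` summand (`Q_{ℂℙ²} = ⟨1⟩`,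
`Q_{ℂℙ²bar} = ⟨−1⟩`, `Q_{X # Y} = Q_X ⊕ Q_Y`; Gompf–Stipsicz 1999, §1.2), i.e. the form of the
homeomorphism type of Akhmedov–Park's `X₁(m)` (`e = 5`, `σ = −1`, `π₁ = 1`).
[cite: Serre1973, Ch. V §1.4.1] -/
def stdOddFormOneTwo : LinearMap.BilinForm ℤ (Fin 3 → ℤ) :=
  Matrix.toBilin' (Matrix.diagonal stdOddSignsOneTwo)

/-- Unfolding lemma. [folklore] -/
theorem stdOddFormOneTwo_def :
    stdOddFormOneTwo = Matrix.toBilin' (Matrix.diagonal ![1, -1, -1]) :=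
  rfl

/-- Values on the standard basis: `(I₊ ⊕ 2I₋)(eᵢ, eⱼ) = diag(1, −1, −1)ᵢⱼ`. [folklore] -/
theorem stdOddFormOneTwo_single (i j : Fin 3) :
    stdOddFormOneTwo (Pi.single i 1) (Pi.single j 1) = Matrix.diagonal ![1, -1, -1] i j := by
  rw [stdOddFormOneTwo_def, Matrix.toBilin'_single]

/-- `I₊ ⊕ 2I₋` is symmetric. [cite: Serre1973, Ch. V §1.4.1] -/
theorem isSymm_stdOddFormOneTwo : stdOddFormOneTwo.IsSymm := by
  rw [stdOddFormOneTwo, Matrix.isSymm_toBilin'_iff_isSymm]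
  exact Matrix.isSymm_diagonal _

/-- `I₊ ⊕ 2I₋` is of type I (odd): `(I₊ ⊕ 2I₋)(e₀, e₀) = 1`. [cite: Serre1973, Ch. V §1.4.1] -/
theorem isOdd_stdOddFormOneTwo : stdOddFormOneTwo.IsOdd :=
  Literature.Topology.FourManifolds.isOdd_toBilin'_diagonal_of_isUnit fun i => by
    fin_cases i <;> simp [stdOddSignsOneTwo]

/-- `I₊ ⊕ 2I₋` is diagonalisable over `ℤ` (the standard basis is orthogonal).
[cite: Serre1973, Ch. V §1.4.1] -/
theorem isDiagonalizable_stdOddFormOneTwo : stdOddFormOneTwo.IsDiagonalizable :=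
  Literature.Topology.FourManifolds.isDiagonalizable_toBilin'_diagonal _

/-- The standard basis of `ℤ³` is orthogonal for `I₊ ⊕ 2I₋`. [folklore] -/
theorem isOrthoᵢ_stdOddFormOneTwo_basisFun :
    LinearMap.IsOrthoᵢ stdOddFormOneTwo (Pi.basisFun ℤ (Fin 3)) := fun i j hij => by
  simp only [Function.onFun, Pi.basisFun_apply, stdOddFormOneTwo, Matrix.toBilin'_single,
    Matrix.diagonal_apply_ne _ hij]

/-- `I₊ ⊕ 2I₋` has rank `3` (`b₂(ℂℙ² # 2ℂℙ²bar) = 3`). [folklore] -/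
theorem finrank_stdOddFormOneTwo : Module.finrank ℤ (Fin 3 → ℤ) = 3 := by
  simp

/-- **`I₊ ⊕ 2I₋` has signature `−1`** (`σ(s I₊ ⊕ t I₋) = s − t`; Serre, Ch. V §1.4.1), the
signature of `ℂℙ² # 2ℂℙ²bar` computed by Akhmedov–Park for `X₁(m)` (`σ = 0 + (−1)`).
[cite: Serre1973, Ch. V §1.4.1] -/
theorem signature_stdOddFormOneTwo : stdOddFormOneTwo.signature = -1 := by
  have hval : ∀ i : Fin 3,
      stdOddFormOneTwo (Pi.basisFun ℤ (Fin 3) i) (Pi.basisFun ℤ (Fin 3) i) = ![1, -1, -1] i := by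
    intro i
    rw [Pi.basisFun_apply, stdOddFormOneTwo_single, Matrix.diagonal_apply_eq]
  have h0 : ∀ i : Fin 3,
      stdOddFormOneTwo (Pi.basisFun ℤ (Fin 3) i) (Pi.basisFun ℤ (Fin 3) i) ≠ 0 := by
    intro i
    rw [hval i]
    fin_cases i <;> simp
  rw [signature_eq_card_sub_card_of_isOrthoᵢ isOrthoᵢ_stdOddFormOneTwo_basisFun h0]
  have hp : Fintype.card {i : Fin 3 //
      0 < stdOddFormOneTwo (Pi.basisFun ℤ (Fin 3) i) (Pi.basisFun ℤ (Fin 3) i)} = 1 := by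
    rw [Fintype.card_subtype]
    simp_rw [hval]
    decide
  have hn : Fintype.card {i : Fin 3 //
      stdOddFormOneTwo (Pi.basisFun ℤ (Fin 3) i) (Pi.basisFun ℤ (Fin 3) i) < 0} = 2 := by
    rw [Fintype.card_subtype]
    simp_rw [hval]
    decide
  rw [hp, hn]
  norm_num

/-! ### Invariants of a 4-manifold with the form `I₊ ⊕ 2I₋` -/

/-- **A closed oriented 4-manifold whose intersection form is isometric to `I₊ ⊕ 2I₋` has
signature `−1`** (`σ(ℂℙ² # 2ℂℙ²bar) = −1`; Akhmedov–Park: `σ(X₁(m)) = 0 + (−1) = −1`).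
[cite: AkhmedovPark2010, proof of Lemma 8] [cite: Serre1973, Ch. V §1.4.1] -/
theorem signature_eq_neg_one_of_equivalent_stdOddFormOneTwo {M : Type*} [TopologicalSpace M]
    (μ : Literature.AlgebraicTopology.SingularHomology.HomologicalOrientation ℤ M 4)
    (h : (Q⟦μ⟧).Equivalent stdOddFormOneTwo) : μ.signature = -1 := by
  rw [Literature.AlgebraicTopology.SingularHomology.HomologicalOrientation.signature,
    signature_eq_of_equivalent h, signature_stdOddFormOneTwo]

/-- **… has an odd (type I) intersection form** (`ℂℙ² # 2ℂℙ²bar` is non-spin).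
[cite: Serre1973, Ch. V §1.4.1] -/
theorem isOdd_intersectionForm_of_equivalent_stdOddFormOneTwo {M : Type*} [TopologicalSpace M]
    (μ : Literature.AlgebraicTopology.SingularHomology.HomologicalOrientation ℤ M 4)
    (h : (Q⟦μ⟧).Equivalent stdOddFormOneTwo) : (Q⟦μ⟧).IsOdd :=
  fun he => isOdd_stdOddFormOneTwo ((isEven_iff_of_equivalent h).mp he)

/-- **… and has `rank H²(M; ℤ)/T = 3`** (`b₂ = 3`, i.e. `e = 2 + b₂ = 5` for simply connected `M`;
Akhmedov–Park: `e(X₁(m)) = 0 + 1 + 4 = 5`). [cite: AkhmedovPark2010, proof of Lemma 8] -/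
theorem finrank_freeCohomology_eq_three_of_equivalent_stdOddFormOneTwo {M : Type*}
    [TopologicalSpace M]
    (μ : Literature.AlgebraicTopology.SingularHomology.HomologicalOrientation ℤ M 4)
    (h : (Q⟦μ⟧).Equivalent stdOddFormOneTwo) :
    Module.finrank ℤ (Literature.AlgebraicTopology.SingularHomology.freeCohomology ℤ M 2) = 3 := by
  obtain ⟨e⟩ := h
  rw [e.toLinearEquiv.finrank_eq, finrank_stdOddFormOneTwo]

/-! ### The Seiberg–Witten leaf: Akhmedov–Park's family `X₁(m)` -/

/-- NAMED FACT (**Akhmedov–Park 2010, Lemma 8 and its proof — the smooth content**; A. Akhmedov,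
B. D. Park, *Exotic smooth structures on small 4-manifolds with odd signatures*, Invent. Math. 181
(2010), §9, Lemma 8: "The set `S_{1,2} = {X₁(m) | m ≥ 1}` consists of irreducible 4-manifolds that
are homeomorphic to `ℂℙ² # 2ℂℙ²bar`. Moreover, `S_{1,2}` contains an infinite subset consisting
of pairwise non-diffeomorphic non-symplectic 4-manifolds"; proof: "`e(X₁(m)) = 5`,
`σ(X₁(m)) = −1`", "`π₁(X₁(m)) = 1`", "compute the Seiberg–Witten invariants of `X₁(m)` and check
that infinitely many of them are distinct … using the product formulas in [MMS]"). **There is a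
sequence `X 0, X 1, …` of simply connected closed smooth 4-manifolds (Hausdorff, second
countable, compact, `C^∞` on `ℝ⁴`, in `Type`) which are pairwise non-diffeomorphic and each of
which carries a `ℤ`-orientation `μ m` whose intersection form is isometric to
`I₊ ⊕ 2I₋ = ⟨1⟩ ⊕ ⟨−1⟩ ⊕ ⟨−1⟩` (`stdOddFormOneTwo`, the form of `ℂℙ² # 2ℂℙ²bar`) and has
`H₂(X m; ℤ) ≅ ℤ³`** (the tree's `Literature.Topology.FourManifolds.singularHomologyZ`). The sequence
is the infinite pairwise non-diffeomorphic subset of `S_{1,2}` re-indexed by `ℕ`; the form and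
`H₂` clauses render "homeomorphic to `ℂℙ² # 2ℂℙ²bar`" / "`e = 5, σ = −1, π₁ = 1`" through
invariants the tree has (`Q_{ℂℙ² # 2ℂℙ²bar} = ⟨1⟩ ⊕ 2⟨−1⟩`, `H₂ ≅ ℤ³`; the `H₂` clause is
redundant given the form clause by Poincaré duality and universal coefficients, kept because the
target states `H₂`). Weaker than printed (irreducibility, the symplectic member `X₁(1)` and the
identification of the homeomorphism type itself are dropped), never stronger. The smooth/gauge
theoretic leaf of `akhmedovPark2010_exotic_bTwo_three`
(`akhmedovPark2010_exotic_bTwo_three_of_wallThmTwo_of_freedman`); not dischargeable without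
Seiberg–Witten theory. Users take `(h : akhmedovPark2010_lemma8_family)`.
[cite: AkhmedovPark2010, Lemma 8 and its proof (§9)] -/
def akhmedovPark2010_lemma8_family : Prop :=
  ∃ (X : ℕ → Type) (_ : ∀ m, TopologicalSpace (X m)) (_ : ∀ m, T2Space (X m))
    (_ : ∀ m, SecondCountableTopology (X m)) (_ : ∀ m, ChartedSpace (𝔼 4) (X m))
    (_ : ∀ m, IsManifold (𝓡 4) ∞ (X m)) (_ : ∀ m, CompactSpace (X m))
    (_ : ∀ m, SimplyConnectedSpace (X m))
    (μ : ∀ m, Literature.AlgebraicTopology.SingularHomology.HomologicalOrientation ℤ (X m) 4),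
    (∀ m, (Q⟦μ m⟧).Equivalent stdOddFormOneTwo) ∧
      (∀ m, Nonempty (Literature.Topology.FourManifolds.singularHomologyZ (X m) 2 ≅
        ModuleCat.of ℤ (Fin 3 → ℤ))) ∧
      ∀ m m', Nonempty (X m ≃ₘ⟮𝓡 4, 𝓡 4⟯ X m') → m = m'

/-! ### Step (c): members of the family are homeomorphic, given Wall and Freedman -/

/-- **Step (c) of the printed proof ("From Freedman's theorem … `X₁(m)` is homeomorphic to
`ℂℙ² # 2ℂℙ²bar`"), for a pair of smooth manifolds with the form `I₊ ⊕ 2I₋`**: GIVEN Wall's Thm. 2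
(`hW`, isometric forms ⇒ h-cobordant) and Freedman's h-cobordism theorem (`hF`, h-cobordant ⇒
homeomorphic), two simply connected closed smooth 4-manifolds whose intersection forms are both
isometric to `I₊ ⊕ 2I₋` are homeomorphic. [cite: AkhmedovPark2010, proof of Lemma 8]
[cite: WallJLMS1964, Thm. 2] [cite: FreedmanJDG1982, Thm. 1.3] -/
theorem nonempty_homeomorph_of_equivalent_stdOddFormOneTwo
    (hW : Literature.Topology.FourManifolds.isHCobordant_of_equivalent_intersectionForm)
    (hF : Literature.Topology.FourManifolds.nonempty_homeomorph_of_isHCobordant_four.{0})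
    (M N : Type) [TopologicalSpace M] [T2Space M] [SecondCountableTopology M]
    [ChartedSpace (𝔼 4) M] [IsManifold (𝓡 4) ∞ M] [CompactSpace M] [SimplyConnectedSpace M]
    [TopologicalSpace N] [T2Space N] [SecondCountableTopology N] [ChartedSpace (𝔼 4) N]
    [IsManifold (𝓡 4) ∞ N] [CompactSpace N] [SimplyConnectedSpace N]
    (μ : Literature.AlgebraicTopology.SingularHomology.HomologicalOrientation ℤ M 4)
    (ν : Literature.AlgebraicTopology.SingularHomology.HomologicalOrientation ℤ N 4)
    (hμ : (Q⟦μ⟧).Equivalent stdOddFormOneTwo) (hν : (Q⟦ν⟧).Equivalent stdOddFormOneTwo) :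
    Nonempty (M ≃ₜ N) :=
  hF (hW M N μ ν (hμ.trans hν.symm))

/-! ### Assembly: Wall + Freedman + the leaf ⇒ the target -/

/-- **Assembly of Akhmedov–Park, Thm. 1 (i), `m = 2`, in the tree's rendering**
(`akhmedovPark2010_exotic_bTwo_three`), from Wall's Thm. 2
(`Literature.Topology.FourManifolds.isHCobordant_of_equivalent_intersectionForm`, `hW`), Freedman's
h-cobordism theorem (`Literature.Topology.FourManifolds.nonempty_homeomorph_of_isHCobordant_four`, `hF`)
and the Seiberg–Witten leaf (`akhmedovPark2010_lemma8_family`, `h8`): take `M := X 0` and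
`N := X`; `H₂(X 0; ℤ) ≅ ℤ³` and pairwise non-diffeomorphism are clauses of the leaf, and each
`X i` is homeomorphic to `X 0` by step (c) (`nonempty_homeomorph_of_equivalent_stdOddFormOneTwo`).
[cite: AkhmedovPark2010, Thm. 1 (i) and Lemma 8] -/
theorem akhmedovPark2010_exotic_bTwo_three_of_wallThmTwo_of_freedman
    (hW : Literature.Topology.FourManifolds.isHCobordant_of_equivalent_intersectionForm)
    (hF : Literature.Topology.FourManifolds.nonempty_homeomorph_of_isHCobordant_four.{0})
    (h8 : akhmedovPark2010_lemma8_family) : akhmedovPark2010_exotic_bTwo_three := by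
  obtain ⟨X, i₁, i₂, i₃, i₄, i₅, i₆, i₇, μ, hQ, hH, hinj⟩ := h8
  exact ⟨X 0, i₁ 0, i₂ 0, i₃ 0, i₄ 0, i₅ 0, i₆ 0, i₇ 0, X, i₁, i₂, i₃, i₄, i₅, i₆, hH 0,
    fun i => nonempty_homeomorph_of_equivalent_stdOddFormOneTwo hW hF (X i) (X 0) (μ i) (μ 0)
      (hQ i) (hQ 0), hinj⟩

/-- **Assembly from the tree's combined Wall fact** (`Literature.Topology.FourManifolds.isHCobordant_and_exists_isStabilization`,
Wall 1964 Thms. 2 ∧ 3, via `Literature.Topology.FourManifolds.isHCobordant_of_equivalent_intersectionForm_of_wall`),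
Freedman's h-cobordism theorem and the leaf. [cite: AkhmedovPark2010, Thm. 1 (i) and Lemma 8] -/
theorem akhmedovPark2010_exotic_bTwo_three_of_wall_of_freedman
    (hW : Literature.Topology.FourManifolds.isHCobordant_and_exists_isStabilization)
    (hF : Literature.Topology.FourManifolds.nonempty_homeomorph_of_isHCobordant_four.{0})
    (h8 : akhmedovPark2010_lemma8_family) : akhmedovPark2010_exotic_bTwo_three :=
  akhmedovPark2010_exotic_bTwo_three_of_wallThmTwo_of_freedman
    (Literature.Topology.FourManifolds.isHCobordant_of_equivalent_intersectionForm_of_wall hW) hF h8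

/-- **The barrier from the three leaves**: GIVEN Wall's Thm. 2, Freedman's h-cobordism theorem and
the Seiberg–Witten leaf, `b₂`-graded rigidity fails at `b₂ = 3` (`SmallExoticaBarrier`, through
`smallExoticaBarrier_of_akhmedovPark`). [cite: AkhmedovPark2010, Thm. 1 (i)] -/
theorem smallExoticaBarrier_of_wallThmTwo_of_freedman_of_lemma8
    (hW : Literature.Topology.FourManifolds.isHCobordant_of_equivalent_intersectionForm)
    (hF : Literature.Topology.FourManifolds.nonempty_homeomorph_of_isHCobordant_four.{0})
    (h8 : akhmedovPark2010_lemma8_family) : SmallExoticaBarrier :=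
  smallExoticaBarrier_of_akhmedovPark
    (akhmedovPark2010_exotic_bTwo_three_of_wallThmTwo_of_freedman hW hF h8)

/-- **The leaf alone already yields pairwise non-diffeomorphic simply connected closed smooth
4-manifolds with isometric intersection forms** — the form in which gauge theory detects exotica
(no homeomorphism asserted, hence no Freedman needed): for `i ≠ j`, `X i` and `X j` have
intersection forms isometric to each other and are not diffeomorphic.
[cite: AkhmedovPark2010, Lemma 8] -/
theorem exists_equivalent_intersectionForm_isEmpty_diffeomorph_of_lemma8
    (h8 : akhmedovPark2010_lemma8_family) :
    ∃ (M N : Type) (_ : TopologicalSpace M) (_ : T2Space M) (_ : SecondCountableTopology M)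
      (_ : ChartedSpace (𝔼 4) M) (_ : IsManifold (𝓡 4) ∞ M) (_ : CompactSpace M)
      (_ : SimplyConnectedSpace M)
      (_ : TopologicalSpace N) (_ : T2Space N) (_ : SecondCountableTopology N)
      (_ : ChartedSpace (𝔼 4) N) (_ : IsManifold (𝓡 4) ∞ N) (_ : CompactSpace N)
      (_ : SimplyConnectedSpace N)
      (μ : Literature.AlgebraicTopology.SingularHomology.HomologicalOrientation ℤ M 4)
      (ν : Literature.AlgebraicTopology.SingularHomology.HomologicalOrientation ℤ N 4),
      (Q⟦μ⟧).Equivalent (Q⟦ν⟧) ∧ IsEmpty (M ≃ₘ⟮𝓡 4, 𝓡 4⟯ N) := by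
  obtain ⟨X, i₁, i₂, i₃, i₄, i₅, i₆, i₇, μ, hQ, -, hinj⟩ := h8
  exact ⟨X 0, X 1, i₁ 0, i₂ 0, i₃ 0, i₄ 0, i₅ 0, i₆ 0, i₇ 0, i₁ 1, i₂ 1, i₃ 1, i₄ 1, i₅ 1, i₆ 1,
    i₇ 1, μ 0, μ 1, (hQ 0).trans (hQ 1).symm, ⟨fun d => absurd (hinj 0 1 ⟨d⟩) zero_ne_one⟩⟩

end Literature.Barriers.SmoothPoincare4

end
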